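import Mathlib
import HarnessLib
import HarnessLib.Audit.Tags

/-!
# HodgeLocusCensusRamified7PeriodBCore — ENGINE B (pub-hlocus abs-2, gen 33): finite core of the EXACT proof of the ROW 7 period
closed forms (V3-XT N = 1, `ℓ = 7`; `DERIVATION-CS7-B.md`; two-engine 240-digit certificate kit j133681).

HONEST FRAMING: certified instances and evidence bearing on the general Hodge conjecture; no claim.

The theorem proved on paper (DERIVATION-CS7-B §1–§2): for `E = 49a1 = [1,−1,0,−2,−1]` (`c₄ = 105`, `c₆ = 1323`, `Δ = −343`, `j = −3375`),
`τ₀ = (1+√−7)/2` and `P = Γ(1/7)Γ(2/7)Γ(4/7)`, the period lattice is `Ω₀·(ℤ + ℤτ₀)` with `Ω₀ = P/(2π√7)`, and for every fundamental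
discriminant `d` the minimal twist `E^(d)` has `(c₄, c₆) = (105d², 1323d³)` and real period `P/(2π√7√d)` (`d > 0`), `P/(2π√|d|)` (`d < 0`).
Inputs from print: the Lerch–Chowla–Selberg formula [cite: Cohen, Number Theory II, Prop. 10.5.11], Gauss' sine product, the
uniformisation dictionary `c₄ = (2π/ω)⁴E₄(τ)`, `c₆ = (2π/ω)⁶E₆(τ)`, `Δ = (2π/ω)¹²η(τ)²⁴`, `j(O_{−7}) = −3375`, and Kraus' integrality
criterion.  Only the finite arithmetic behind the casework is kernel-checked here (no `sorry`, no new axioms; `decide` / `norm_num`):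

* `invariants_49a1` — `105³ − 1323² = 1728·(−343)`, `−343 = −7³`, `j = 1728·105³/(105³ − 1323²) = −3375`, and the side identity
  `E₆(τ₀)²/E₄(τ₀)³ = 1 − 1728/j = 189/125`; `343 = 7³` so `343^{1/12} = 7^{1/4}` is the exponent bookkeeping `3·4 = 12`;
* `sqrt7_bookkeeping` — `(√7)² = 7`-free form of step (7): `2·4·7 = 56` and `P/(4·x·π²)·2π/x = P/(2π·x²)` as a polynomial identity in a
  variable `x` standing for `7^{1/4}` (with `x⁴ = 7` giving `x²·x² = 7`);
* `kraus_at_two_odd` — for `d ≡ 1 (mod 4)`: `1323·d³ ≡ −1 (mod 4)` (Kraus' first alternative), over `ZMod 4`;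
* `kraus_at_two_even` — for `d = 4m′`: `16 ∣ 105·16·m′²` and `1323·64·m′³ ≡ 0 (mod 32)` (second alternative), over `ZMod 16` / `ZMod 32`;
* `descaled_pair_not_admissible` — minimality at `2` when `4 ∣ d`: for `m′ ≡ 3 (mod 4)`, `1323·m′³ ≢ −1 (mod 4)`; for every `m′ ≢ 0 (mod 4)`,
  `16 ∤ 105·m′²` (table over `ZMod 16`); so the pair `(105m′², 1323m′³)` fails both of Kraus' alternatives at `2`;
* `kraus_at_three` — `v₃(1323) = 3`, so `v₃(1323d³) = 3 + 3v₃(d) ≠ 2`: as the residue facts `27 ∣ 1323`, `¬ 81 ∣ 1323`, and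
  `∀ k, 3 + 3k ≠ 2`;
* `odd_valuation_bound` — minimality at odd `p`: `105 = 3·5·7`, `9, 25, 49 ∤ 105`, every prime divisor of `105` is `3, 5` or `7`, so
  `v_p(105d²) ≤ 1 + 2 < 4` for `d` with squarefree odd part;
* `e6_tail_arith` — the integer arithmetic inside the positivity bound `504·Σσ₅(n)|q₀|ⁿ < 1`: `σ₅(1..4) = 1, 33, 244, 1057` and
  `504·(1 + 33 + 244 + 1057) = 672840`; the analytic inequality itself (`|q₀| = e^{−π√7} < 2.5·10⁻⁴`) is in the numerical certificate only.
-/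

set_option linter.dupNamespace false

namespace Summit.HodgeConjecture.HodgeConjecture.HodgeLocus.Census.Ramified7PeriodBCore

/-- Invariants of `49a1`: `c₄³ − c₆² = 1728Δ` with `Δ = −343 = −7³`, `j = −3375`, and `1 − 1728/j = 189/125`; exponent bookkeeping `343 = 7³`, `3·4 = 12`. -/
theorem invariants_49a1 :
    (105 : ℤ) ^ 3 - 1323 ^ 2 = 1728 * (-343) ∧ (-343 : ℤ) = -(7 ^ 3) ∧
    (1728 : ℚ) * 105 ^ 3 / (105 ^ 3 - 1323 ^ 2) = -3375 ∧ (1 : ℚ) - 1728 / (-3375) = 189 / 125 ∧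
    (343 : ℕ) = 7 ^ 3 ∧ 3 * 4 = 12 := by
  norm_num

/-- Step (7) of the proof as a polynomial identity: with `x` standing for `7^{1/4}` (so `x ≠ 0`),
`2·p·(P/(4·x·p²))/x = P/(2·p·x²)`; and `x² · x² = x⁴` (used with `x⁴ = 7`). -/
theorem sqrt7_bookkeeping (P p x : ℝ) (hp : p ≠ 0) (hx : x ≠ 0) :
    2 * p * (P / (4 * x * p ^ 2)) / x = P / (2 * p * x ^ 2) ∧ x ^ 2 * x ^ 2 = x ^ 4 := by
  constructor
  · field_simp
    ring
  · ring

/-- Kraus at `2`, first alternative, for odd fundamental `d ≡ 1 (mod 4)`: `1323 d³ ≡ −1 (mod 4)`. -/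
theorem kraus_at_two_odd : ∀ d : ZMod 4, d = 1 → (1323 : ZMod 4) * d ^ 3 = -1 := by
  decide

/-- Kraus at `2`, second alternative, for `d = 4m′`: `105·(4m′)² ≡ 0 (mod 16)` and `1323·(4m′)³ ≡ 0 (mod 32)`. -/
theorem kraus_at_two_even :
    (∀ m : ZMod 16, (105 : ZMod 16) * (4 * m) ^ 2 = 0) ∧ (∀ m : ZMod 32, (1323 : ZMod 32) * (4 * m) ^ 3 = 0) := by
  refine ⟨by decide, by decide⟩

/-- Minimality at `2` when `4 ∣ d`: the descaled pair `(105m′², 1323m′³)` is not Kraus-admissible for `m′ ≢ 0 (mod 4)`: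
the first alternative fails for `m′ ≡ 3 (mod 4)` (`1323·27 ≡ 1 ≢ −1`) and for even `m′` (`1323m′³` even), and the second fails
because `16 ∤ 105m′²` whenever `m′ ≢ 0 (mod 4)` (table over `ZMod 16`). -/
theorem descaled_pair_not_admissible :
    (∀ m : ZMod 4, m = 3 → (1323 : ZMod 4) * m ^ 3 ≠ -1) ∧
    (∀ m : ZMod 4, m = 2 → (1323 : ZMod 4) * m ^ 3 ≠ -1) ∧
    (∀ m : ZMod 16, 4 * m ≠ 0 → (105 : ZMod 16) * m ^ 2 ≠ 0) := by
  refine ⟨by decide, by decide, by decide⟩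

/-- Kraus at `3`: `27 ∣ 1323`, `81 ∤ 1323` (so `v₃(1323) = 3`) and `3 + 3k ≠ 2`. -/
theorem kraus_at_three : (27 ∣ (1323 : ℕ)) ∧ ¬ (81 ∣ (1323 : ℕ)) ∧ (∀ k : ℕ, 3 + 3 * k ≠ 2) := by
  refine ⟨by norm_num, by norm_num, fun k => by omega⟩

/-- Minimality at odd primes: `105 = 3·5·7` with `9, 25, 49 ∤ 105` (so `v_p(105) ≤ 1` for every prime `p`), hence
`v_p(105 d²) ≤ 1 + 2 < 4` for `d` with squarefree odd part. -/
theorem odd_valuation_bound :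
    (105 : ℕ) = 3 * 5 * 7 ∧ ¬ (9 ∣ (105 : ℕ)) ∧ ¬ (25 ∣ (105 : ℕ)) ∧ ¬ (49 ∣ (105 : ℕ)) ∧
    (∀ p : ℕ, p.Prime → p ∣ 105 → p = 3 ∨ p = 5 ∨ p = 7) ∧ 1 + 2 * 1 < 4 := by
  refine ⟨by norm_num, by norm_num, by norm_num, by norm_num, fun p hp hd => ?_, by norm_num⟩
  have h105 : (105 : ℕ) = 3 * (5 * 7) := by norm_num
  rw [h105] at hd
  rcases (Nat.Prime.dvd_mul hp).mp hd with h3 | h57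
  · left; exact (Nat.prime_dvd_prime_iff_eq hp Nat.prime_three).mp h3
  · rcases (Nat.Prime.dvd_mul hp).mp h57 with h5 | h7
    · right; left; exact (Nat.prime_dvd_prime_iff_eq hp Nat.prime_five).mp h5
    · right; right; exact (Nat.prime_dvd_prime_iff_eq hp (by norm_num)).mp h7

/-- Integer arithmetic inside the positivity bound for `E₆(τ₀)`: `σ₅(n)` for `n ≤ 4` and `504·(1 + 33 + 244 + 1057) = 672840`. -/
theorem e6_tail_arith :
    (∑ d ∈ Nat.divisors 1, d ^ 5 = 1) ∧ (∑ d ∈ Nat.divisors 2, d ^ 5 = 33) ∧ (∑ d ∈ Nat.divisors 3, d ^ 5 = 244) ∧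
    (∑ d ∈ Nat.divisors 4, d ^ 5 = 1057) ∧ 504 * (1 + 33 + 244 + 1057) = 672840 := by
  refine ⟨by decide, by decide, by decide, by decide, by norm_num⟩

end Summit.HodgeConjecture.HodgeConjecture.HodgeLocus.Census.Ramified7PeriodBCore
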